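import Literature.RingTheory.Henselian.FiniteAlgebraProductOfLocalizations
import Literature.RingTheory.Idempotents.AlgHomCornerOfReduction
import Mathlib.RingTheory.HopfAlgebra.Convolution
import HarnessLib

/-!
# Translations by rational points are automorphisms permuting the local factors of a finite group scheme
# ([Tate1997FiniteFlatGroupSchemes] (3.7); [StacksProject] Tag 04GG) — algebra side, via Mathlib's convolution group

Topic `Literature/RingTheory/Henselian`; namespace `Literature.RingTheory.Henselian` (sibling of ★ `FiniteAlgebraProductOfLocalizations`, per F0P5a-plan (g5) 06:49:19Z).
PROOF FILE (theorems only; no definition, no named fact, no instance, no notation, no `sorry`).  Cell `hodgecm-mathlib`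
(D-0151), FLOOR-0 P5a row G3, head (iii) «translations permute the factors ⇒ equal ranks» of F0P5a-plan (g5)'s
G-QUEUE WORD 06:49:19Z (1)(f) and (e).  Sibling of `Henselian/FiniteFlatHopfAlgebraLocalFactors` ∕ `…UnitFactor` (the local
factors, the unit factor and «`G⁰ G⁰ = G⁰`»); independent of them.

Everything is phrased DEF-FREE through Mathlib's convolution monoid∕group `WithConv (B →ₐ[R] C)`
(`Mathlib.RingTheory.Bialgebra.Convolution`, `Mathlib.RingTheory.HopfAlgebra.Convolution`): for a commutative bialgebra
`B` over `R` (`G = Spec B`) and an `R`-point `g : B →ₐ[R] R`, the LEFT TRANSLATION `T_g : B →ₐ[R] B` is the convolution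
`(η ∘ g) * id` of `η ∘ g : B → R → B` with the identity, i.e. `b ↦ Σ g(xᵢ) yᵢ` for `Δ b = Σ xᵢ ⊗ yᵢ` (`translate_apply`).

* §1 separating idempotents (any commutative ring `B`): an idempotent in every maximal ideal is `0`
  (`eq_zero_of_isIdempotentElem_of_forall_mem`); the separating idempotent at an ideal `𝔫` (`e ≡ 1 (mod 𝔫)`, `e ∈ 𝔫'`
  for every maximal `𝔫' ≠ 𝔫`) is UNIQUE (`separatingIdempotent_unique`), hence is carried to the separating idempotent at
  `𝔫'` by any algebra automorphism `σ` with `σ⁻¹(𝔫') = 𝔫` (`map_separatingIdempotent_eq`).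
* §2 translations: `ε ∘ T_g = g` (`counitAlgHom_comp_translate`), `T_h ∘ T_g = T_{g*h}` (`translate_comp_translate`,
  from Mathlib `AlgHom.comp_convMul_distrib` + associativity — no coassociativity bookkeeping by hand), `T_ε = id`
  (`translate_counit`), `T_g⁻¹(𝔫₁) = 𝔫_g := ker(B →g R → k)` (`comap_translate_ker_residue_counit`, `R` local); over a
  HOPF algebra `T_{g⁻¹} ∘ T_g = id = T_g ∘ T_{g⁻¹}` with `g⁻¹ = g ∘ S` (`translate_inv_comp_translate`, Mathlib
  `AlgHom.convGroup`) and `T_g` is bijective (`translate_bijective`).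
* §3 (Hopf, `R` local) **`nonempty_algEquiv_corner_unitCorner`**: `T_g` maps the separating idempotent `e` at `𝔫_g` to
  the unit idempotent `e₁` at `𝔫₁ = ker(B →ε R → k)`, so `B ⧸ (1 - e) ≃ₐ[R] B ⧸ (1 - e₁)` — the local factor of `G` at
  the reduction of ANY rational point is isomorphic to the unit factor; **`finrank_corner_eq_finrank_unitCorner`**: equal
  `R`-ranks («translations permute the connected components», Tate (3.7)).
* §4 LOCAL-FACTOR CURRENCY (`Localization.AtPrime`, no idempotents in the statements): an `R`-algebra automorphism `σ` with
  `σ⁻¹ 𝔫' = 𝔫` induces `Localization.AtPrime 𝔫 ≃ₐ[R] Localization.AtPrime 𝔫'` (Mathlib `IsLocalization.algEquivOfAlgEquiv`;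
  `nonempty_algEquiv_localization_of_comap_eq`), hence **`nonempty_algEquiv_localization_ker_localization_ker_counit`** and
  **`finrank_localization_ker_eq_finrank_localization_ker_counit`**: for every `R`-point `φ` of a commutative Hopf algebra over a
  local `R`, `B_{𝔫_φ} ≃ₐ[R] B_{𝔫_ε}` and the two local factors have the same `R`-rank; and the REDUCTION MAP `φ ↦ residue ∘ φ`
  is multiplicative for convolution (`residue_comp_convMul`), with `residue ∘ φ = residue ∘ ε ⇔ 𝔫_φ = 𝔫_ε`
  (`residue_comp_eq_iff_ker_eq`) — head (e).

HC_CM is proved only modulo the 7 printed citations until rung 0 closes; this file is generic algebra and changes no count.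

## References
* [Tate1997FiniteFlatGroupSchemes] J. Tate, *Finite flat group schemes*, in: Cornell–Silverman–Stevens (eds.), *Modular
  Forms and Fermat's Last Theorem* (Springer 1997), (3.7) (connected components of a finite group scheme over a henselian
  local ring; `G = ⊔ G_i`, translations).
* [StacksProject] The Stacks Project, Tag 04GG (Algebra, Lemma 10.153.3).
-/

set_option autoImplicit false

noncomputable section

universe u v

open IsLocalRing TensorProduct WithConv

namespace Literature.RingTheory.Henselian

/-! ## §1 Separating idempotents are unique -/

section Separating

variable {B : Type v} [CommRing B]

/-- An idempotent lying in every maximal ideal is `0` (it lies in the Jacobson radical, so `1 - f` is a unit).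
[cite: AtiyahMacdonald1969, Prop. 1.9] -/
theorem eq_zero_of_isIdempotentElem_of_forall_mem {f : B} (hf : IsIdempotentElem f)
    (hmem : ∀ 𝔫 : Ideal B, 𝔫.IsMaximal → f ∈ 𝔫) : f = 0 := by
  have hjac : f ∈ (⊥ : Ideal B).jacobson := by
    rw [Ideal.jacobson, Ideal.mem_sInf]
    rintro 𝔫 ⟨-, h𝔫⟩
    exact hmem 𝔫 h𝔫
  obtain ⟨u, hu⟩ : IsUnit (1 - f) := by
    have := Ideal.mem_jacobson_bot.1 hjac (-1)
    rwa [mul_neg, mul_one, neg_add_eq_sub] at this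
  have h0 : (1 - f) * f = 0 := by rw [sub_mul, one_mul, hf.eq, sub_self]
  have := congrArg (fun x => (↑u⁻¹ : B) * x) h0
  simpa [← hu, ← mul_assoc] using this

/-- **The separating idempotent at a maximal ideal is unique**: two idempotents `≡ 1 (mod 𝔫)` lying in every OTHER
maximal ideal coincide (`e (1 - e')` and `e' (1 - e)` are idempotents in the Jacobson radical). [cite: StacksProject, Tag 04GG] -/
theorem separatingIdempotent_unique (𝔫 : Ideal B) {e e' : B} (he : IsIdempotentElem e)
    (he' : IsIdempotentElem e') (he1 : e - 1 ∈ 𝔫) (he0 : ∀ 𝔫' : Ideal B, 𝔫'.IsMaximal → 𝔫' ≠ 𝔫 → e ∈ 𝔫')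
    (he'1 : e' - 1 ∈ 𝔫) (he'0 : ∀ 𝔫' : Ideal B, 𝔫'.IsMaximal → 𝔫' ≠ 𝔫 → e' ∈ 𝔫') : e = e' := by
  have hmem : ∀ {a b : B}, (∀ 𝔫' : Ideal B, 𝔫'.IsMaximal → 𝔫' ≠ 𝔫 → a ∈ 𝔫') → b - 1 ∈ 𝔫 →
      ∀ 𝔫' : Ideal B, 𝔫'.IsMaximal → a * (1 - b) ∈ 𝔫' := by
    intro a b ha0 hb1 𝔫' h𝔫'
    by_cases h : 𝔫' = 𝔫
    · subst h
      refine Ideal.mul_mem_left _ _ ?_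
      have := (Ideal.neg_mem_iff _).2 hb1
      rwa [neg_sub] at this
    · exact Ideal.mul_mem_right _ _ (ha0 𝔫' h𝔫' h)
  have h1 : e * (1 - e') = 0 := eq_zero_of_isIdempotentElem_of_forall_mem (he.mul he'.one_sub) (hmem he0 he'1)
  have h2 : e' * (1 - e) = 0 := eq_zero_of_isIdempotentElem_of_forall_mem (he'.mul he.one_sub) (hmem he'0 he1)
  have h1' : e = e * e' := by rw [mul_sub, mul_one, sub_eq_zero] at h1; exact h1
  have h2' : e' = e' * e := by rw [mul_sub, mul_one, sub_eq_zero] at h2; exact h2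
  exact h1'.trans ((mul_comm e e').trans h2'.symm)

/-- An algebra automorphism `σ` carrying the maximal ideal `𝔫` onto `𝔫'` (`comap σ 𝔫' = 𝔫`) carries the separating
idempotent at `𝔫` to the separating idempotent at `𝔫'`. [cite: StacksProject, Tag 04GG] -/
theorem map_separatingIdempotent_eq {R : Type u} [CommRing R] [Algebra R B] (σ : B ≃ₐ[R] B)
    (𝔫 𝔫' : Ideal B) (hσ : 𝔫'.comap (σ : B →+* B) = 𝔫) {e e' : B} (he : IsIdempotentElem e)
    (he' : IsIdempotentElem e') (he1 : e - 1 ∈ 𝔫) (he0 : ∀ 𝔪 : Ideal B, 𝔪.IsMaximal → 𝔪 ≠ 𝔫 → e ∈ 𝔪)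
    (he'1 : e' - 1 ∈ 𝔫') (he'0 : ∀ 𝔪 : Ideal B, 𝔪.IsMaximal → 𝔪 ≠ 𝔫' → e' ∈ 𝔪) : σ e = e' := by
  refine separatingIdempotent_unique 𝔫' (he.map (σ : B →ₐ[R] B)) he' ?_ (fun 𝔪 h𝔪 hne => ?_) he'1 he'0
  · have : e - 1 ∈ 𝔫'.comap (σ : B →+* B) := hσ ▸ he1
    simpa [Ideal.mem_comap] using this
  · have hmax : (𝔪.comap (σ : B →+* B)).IsMaximal := Ideal.comap_isMaximal_of_surjective _ σ.surjective
    have hne' : 𝔪.comap (σ : B →+* B) ≠ 𝔫 := fun h =>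
      hne (Ideal.comap_injective_of_surjective (σ : B →+* B) σ.surjective (h.trans hσ.symm))
    have := he0 _ hmax hne'
    simpa [Ideal.mem_comap] using this

end Separating

/-! ## §2 Left translations by `R`-points as convolutions -/

section Translation

variable {R : Type u} [CommRing R] {B : Type v} [CommRing B]

section Bialg

variable [Bialgebra R B]

/-- The LEFT TRANSLATION by an `R`-point `g : B → R` of `G = Spec B` is the convolution `(η ∘ g) * id` in Mathlib's
convolution monoid `WithConv (B →ₐ[R] B)`; on a representation `Δ b = Σ xᵢ ⊗ yᵢ` it is `b ↦ Σ g(xᵢ) yᵢ`.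
[cite: StacksProject, Tag 04GG] -/
theorem translate_apply {ι : Type*} (g : B →ₐ[R] R) (b : B) (repr : Coalgebra.Repr R b ι) :
    (toConv ((Algebra.ofId R B).comp g) * toConv (AlgHom.id R B)).ofConv b =
      ∑ i ∈ repr.index, g (repr.left i) • repr.right i := by
  rw [AlgHom.convMul_apply, ← repr.eq, map_sum]
  refine Finset.sum_congr rfl fun i _ => ?_
  simp [Algebra.TensorProduct.lift_tmul, Algebra.ofId_apply, Algebra.smul_def]

/-- `ε ∘ T_g = g`: the translate of the unit point is `g`. [cite: StacksProject, Tag 04GG] -/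
theorem counitAlgHom_comp_translate (g : B →ₐ[R] R) :
    (Bialgebra.counitAlgHom R B).comp (toConv ((Algebra.ofId R B).comp g) * toConv (AlgHom.id R B)).ofConv = g := by
  rw [AlgHom.comp_convMul_distrib, ← AlgHom.comp_assoc]
  have h1 : (Bialgebra.counitAlgHom R B).comp (Algebra.ofId R B) = AlgHom.id R R := by
    ext
  rw [h1, AlgHom.id_comp, AlgHom.comp_id]
  have h2 : toConv (Bialgebra.counitAlgHom R B) = (1 : WithConv (B →ₐ[R] R)) := by
    rw [AlgHom.convOne_def]; rfl
  rw [h2, mul_one]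

/-- **Translations compose by convolution**: `T_h ∘ T_g = T_{g * h}`. [cite: StacksProject, Tag 04GG] -/
theorem translate_comp_translate (g h : B →ₐ[R] R) :
    (toConv ((Algebra.ofId R B).comp h) * toConv (AlgHom.id R B)).ofConv.comp
        (toConv ((Algebra.ofId R B).comp g) * toConv (AlgHom.id R B)).ofConv =
      (toConv ((Algebra.ofId R B).comp (toConv g * toConv h).ofConv) * toConv (AlgHom.id R B)).ofConv := by
  rw [AlgHom.comp_convMul_distrib, AlgHom.comp_id, ← AlgHom.comp_assoc]
  -- `T_h ∘ η = η` since `T_h` is an `R`-algebra map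
  have h1 : ((toConv ((Algebra.ofId R B).comp h) * toConv (AlgHom.id R B)).ofConv).comp (Algebra.ofId R B) =
      Algebra.ofId R B := by ext
  rw [h1, AlgHom.comp_convMul_distrib, ← mul_assoc]

/-- The translation by the unit point `ε` is the identity. [cite: StacksProject, Tag 04GG] -/
theorem translate_counit :
    (toConv ((Algebra.ofId R B).comp (Bialgebra.counitAlgHom R B)) * toConv (AlgHom.id R B)).ofConv =
      AlgHom.id R B := by
  have : toConv ((Algebra.ofId R B).comp (Bialgebra.counitAlgHom R B)) = (1 : WithConv (B →ₐ[R] B)) := by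
    rw [AlgHom.convOne_def]
  rw [this, one_mul]

/-- `T_g` pulls the unit maximal ideal `𝔫₁ = ker(B →ε R → k)` back to the reduction `𝔫_g = ker(B →g R → k)` of `g`
(`R` local). [cite: StacksProject, Tag 04GG] -/
theorem comap_translate_ker_residue_counit [IsLocalRing R] (g : B →ₐ[R] R) :
    (RingHom.ker ((residue R).comp (Bialgebra.counitAlgHom R B : B →+* R))).comap
        ((toConv ((Algebra.ofId R B).comp g) * toConv (AlgHom.id R B)).ofConv : B →+* B) =
      RingHom.ker ((residue R).comp (g : B →+* R)) := by
  rw [RingHom.comap_ker, RingHom.comp_assoc, ← AlgHom.comp_toRingHom, counitAlgHom_comp_translate]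

end Bialg

section Hopf

variable [HopfAlgebra R B]

/-- Over a HOPF algebra the translations are automorphisms: `T_{g⁻¹} ∘ T_g = id = T_g ∘ T_{g⁻¹}` with `g⁻¹ = g ∘ S` the
convolution inverse (Mathlib `AlgHom.convGroup`). [cite: StacksProject, Tag 04GG] -/
theorem translate_inv_comp_translate (g : B →ₐ[R] R) :
    (toConv ((Algebra.ofId R B).comp (toConv g)⁻¹.ofConv) * toConv (AlgHom.id R B)).ofConv.comp
        (toConv ((Algebra.ofId R B).comp g) * toConv (AlgHom.id R B)).ofConv = AlgHom.id R B ∧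
    (toConv ((Algebra.ofId R B).comp g) * toConv (AlgHom.id R B)).ofConv.comp
        (toConv ((Algebra.ofId R B).comp (toConv g)⁻¹.ofConv) * toConv (AlgHom.id R B)).ofConv = AlgHom.id R B := by
  have h1 : (Algebra.ofId R B).comp (ofConv (1 : WithConv (B →ₐ[R] R))) =
      (Algebra.ofId R B).comp (Bialgebra.counitAlgHom R B) := by
    ext b
    simp [AlgHom.convOne_apply, Algebra.ofId_apply]
  constructor
  · rw [translate_comp_translate, toConv_ofConv, mul_inv_cancel, h1]
    exact translate_counit
  · rw [translate_comp_translate, toConv_ofConv, inv_mul_cancel, h1]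
    exact translate_counit

/-- The translation `T_g` is bijective (Hopf case). [cite: StacksProject, Tag 04GG] -/
theorem translate_bijective (g : B →ₐ[R] R) :
    Function.Bijective (toConv ((Algebra.ofId R B).comp g) * toConv (AlgHom.id R B)).ofConv := by
  obtain ⟨h1, h2⟩ := translate_inv_comp_translate (R := R) g
  refine Function.bijective_iff_has_inverse.2
    ⟨(toConv ((Algebra.ofId R B).comp (toConv g)⁻¹.ofConv) * toConv (AlgHom.id R B)).ofConv,
      fun b => ?_, fun b => ?_⟩
  · exact congrArg (fun φ : B →ₐ[R] B => φ b) h1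
  · exact congrArg (fun φ : B →ₐ[R] B => φ b) h2

end Hopf

/-! ## §3 Translations permute the local factors: equal ranks at all `R`-points -/

section Ranks

variable [IsLocalRing R] [HopfAlgebra R B]

/-- **Translation by `g` carries the corner at the reduction of `g` onto the unit corner.**  Let `e₁` be the
separating idempotent at the unit maximal ideal `𝔫₁ = ker(B →ε R → k)` and `e` the one at `𝔫_g = ker(B →g R → k)`;
then the translation `T_g` maps `e ↦ e₁`, so `B ⧸ (1 - e) ≃ₐ[R] B ⧸ (1 - e₁)`: all local factors of `G = Spec B` at
`R`-rational points are isomorphic to the unit factor. [cite: Tate1997FiniteFlatGroupSchemes, (3.7)] -/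
theorem nonempty_algEquiv_corner_unitCorner (g : B →ₐ[R] R) {e₁ e : B} (he₁ : IsIdempotentElem e₁)
    (he₁1 : e₁ - 1 ∈ RingHom.ker ((residue R).comp (Bialgebra.counitAlgHom R B : B →+* R)))
    (he₁0 : ∀ 𝔪 : Ideal B, 𝔪.IsMaximal → 𝔪 ≠ RingHom.ker ((residue R).comp (Bialgebra.counitAlgHom R B : B →+* R)) →
      e₁ ∈ 𝔪)
    (he : IsIdempotentElem e) (he1 : e - 1 ∈ RingHom.ker ((residue R).comp (g : B →+* R)))
    (he0 : ∀ 𝔪 : Ideal B, 𝔪.IsMaximal → 𝔪 ≠ RingHom.ker ((residue R).comp (g : B →+* R)) → e ∈ 𝔪) :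
    Nonempty ((B ⧸ Ideal.span {1 - e}) ≃ₐ[R] (B ⧸ Ideal.span {1 - e₁})) := by
  set σ : B ≃ₐ[R] B := AlgEquiv.ofBijective _ (translate_bijective (R := R) g) with hσdef
  have hσ : (RingHom.ker ((residue R).comp (Bialgebra.counitAlgHom R B : B →+* R))).comap (σ : B →+* B) =
      RingHom.ker ((residue R).comp (g : B →+* R)) := by
    rw [← comap_translate_ker_residue_counit (R := R) g]
    ext x
    exact Iff.rfl
  have hσe : σ e = e₁ := map_separatingIdempotent_eq σ _ _ hσ he he₁ he1 he0 he₁1 he₁0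
  refine ⟨Ideal.quotientEquivAlg (Ideal.span {1 - e}) (Ideal.span {1 - e₁}) σ ?_⟩
  rw [Ideal.map_span, Set.image_singleton]
  congr 2
  change 1 - e₁ = σ (1 - e)
  rw [map_sub, map_one, hσe]

/-- **Equal ranks of the local factors at rational points**: with `e₁, e` as above,
`rank_R (B ⧸ (1 - e)) = rank_R (B ⧸ (1 - e₁))`. [cite: Tate1997FiniteFlatGroupSchemes, (3.7)] -/
theorem finrank_corner_eq_finrank_unitCorner (g : B →ₐ[R] R) {e₁ e : B} (he₁ : IsIdempotentElem e₁)
    (he₁1 : e₁ - 1 ∈ RingHom.ker ((residue R).comp (Bialgebra.counitAlgHom R B : B →+* R)))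
    (he₁0 : ∀ 𝔪 : Ideal B, 𝔪.IsMaximal → 𝔪 ≠ RingHom.ker ((residue R).comp (Bialgebra.counitAlgHom R B : B →+* R)) →
      e₁ ∈ 𝔪)
    (he : IsIdempotentElem e) (he1 : e - 1 ∈ RingHom.ker ((residue R).comp (g : B →+* R)))
    (he0 : ∀ 𝔪 : Ideal B, 𝔪.IsMaximal → 𝔪 ≠ RingHom.ker ((residue R).comp (g : B →+* R)) → e ∈ 𝔪) :
    Module.finrank R (B ⧸ Ideal.span {1 - e}) = Module.finrank R (B ⧸ Ideal.span {1 - e₁}) := by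
  obtain ⟨φ⟩ := nonempty_algEquiv_corner_unitCorner (R := R) g he₁ he₁1 he₁0 he he1 he0
  exact φ.toLinearEquiv.finrank_eq

end Ranks

end Translation

/-! ## §4 Local-factor currency: `Localization.AtPrime B 𝔫_φ ≃ₐ[R] Localization.AtPrime B 𝔫_ε`; the reduction homomorphism -/

section LocalFactors

variable {R : Type u} [CommRing R] {B : Type v} [CommRing B]

section Generic

variable [Algebra R B]

/-- An `R`-algebra automorphism `σ` of `B` with `σ⁻¹ 𝔫' = 𝔫` (`𝔫, 𝔫'` primes) induces an `R`-algebra isomorphism of the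
local factors `B_𝔫 ≃ₐ[R] B_{𝔫'}` (Mathlib `IsLocalization.algEquivOfAlgEquiv`). [cite: StacksProject, Tag 04GG] -/
theorem nonempty_algEquiv_localization_of_comap_eq (σ : B ≃ₐ[R] B) (𝔫 𝔫' : Ideal B) [𝔫.IsPrime] [𝔫'.IsPrime] (hσ : 𝔫'.comap (σ : B →+* B) = 𝔫) :
    Nonempty (Localization.AtPrime 𝔫 ≃ₐ[R] Localization.AtPrime 𝔫') := by
  refine ⟨IsLocalization.algEquivOfAlgEquiv (M := 𝔫.primeCompl) (T := 𝔫'.primeCompl) (Localization.AtPrime 𝔫)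
    (Localization.AtPrime 𝔫') σ ?_⟩
  ext x
  simp only [Submonoid.mem_map, Ideal.mem_primeCompl_iff]
  constructor
  · rintro ⟨y, hy, rfl⟩
    intro hx
    apply hy
    have : y ∈ 𝔫'.comap (σ : B →+* B) := by simpa [Ideal.mem_comap] using hx
    rwa [hσ] at this
  · intro hx
    refine ⟨σ.symm x, fun hy => hx ?_, by simp⟩
    rw [← hσ, Ideal.mem_comap] at hy
    simpa using hy

end Generic

section HopfLocal

variable [IsLocalRing R] [HopfAlgebra R B]


/-- **The local factor at the reduction of any rational point is isomorphic to the unit factor**: for an `R`-point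
`φ : B →ₐ[R] R` of a commutative Hopf algebra over a local ring `R`,
`Localization.AtPrime B 𝔫_φ ≃ₐ[R] Localization.AtPrime B 𝔫_ε` with `𝔫_φ = ker(B →φ R → k)`, `𝔫_ε = ker(B →ε R → k)`
(the translation `T_φ` is an automorphism with `T_φ⁻¹ 𝔫_ε = 𝔫_φ`). [cite: Tate1997FiniteFlatGroupSchemes, (3.7)] -/
theorem nonempty_algEquiv_localization_ker_localization_ker_counit (φ : B →ₐ[R] R) :
    haveI := (Literature.RingTheory.Idempotents.isMaximal_ker_residue_comp φ).1
    haveI := (Literature.RingTheory.Idempotents.isMaximal_ker_residue_comp (Bialgebra.counitAlgHom R B)).1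
    Nonempty (Localization.AtPrime (RingHom.ker ((residue R).comp (φ : B →+* R))) ≃ₐ[R]
      Localization.AtPrime (RingHom.ker ((residue R).comp (Bialgebra.counitAlgHom R B : B →+* R)))) := by
  haveI := (Literature.RingTheory.Idempotents.isMaximal_ker_residue_comp φ).1
  haveI := (Literature.RingTheory.Idempotents.isMaximal_ker_residue_comp (Bialgebra.counitAlgHom R B)).1
  set σ : B ≃ₐ[R] B := AlgEquiv.ofBijective _ (translate_bijective (R := R) φ) with hσdef
  have hσ : (RingHom.ker ((residue R).comp (Bialgebra.counitAlgHom R B : B →+* R))).comap (σ : B →+* B) =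
      RingHom.ker ((residue R).comp (φ : B →+* R)) := by
    rw [← comap_translate_ker_residue_counit (R := R) φ]
    ext x
    exact Iff.rfl
  exact nonempty_algEquiv_localization_of_comap_eq σ _ _ hσ

/-- **Equal ranks of the local factors at rational points** (local-factor currency):
`rank_R B_{𝔫_φ} = rank_R B_{𝔫_ε}` for every `R`-point `φ`. [cite: Tate1997FiniteFlatGroupSchemes, (3.7)] -/
theorem finrank_localization_ker_eq_finrank_localization_ker_counit (φ : B →ₐ[R] R) :
    haveI := (Literature.RingTheory.Idempotents.isMaximal_ker_residue_comp φ).1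
    haveI := (Literature.RingTheory.Idempotents.isMaximal_ker_residue_comp (Bialgebra.counitAlgHom R B)).1
    Module.finrank R (Localization.AtPrime (RingHom.ker ((residue R).comp (φ : B →+* R)))) =
      Module.finrank R (Localization.AtPrime (RingHom.ker ((residue R).comp (Bialgebra.counitAlgHom R B : B →+* R)))) := by
  haveI := (Literature.RingTheory.Idempotents.isMaximal_ker_residue_comp φ).1
  haveI := (Literature.RingTheory.Idempotents.isMaximal_ker_residue_comp (Bialgebra.counitAlgHom R B)).1
  obtain ⟨θ⟩ := nonempty_algEquiv_localization_ker_localization_ker_counit (R := R) (B := B) φ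
  exact θ.toLinearEquiv.finrank_eq

omit [IsLocalRing R] in
/-- **The reduction map on points is multiplicative**: composing with an `R`-algebra map `χ : R → C` (e.g. the residue map
`R → k`) commutes with the convolution product of points (Mathlib `AlgHom.comp_convMul_distrib`). [cite: Tate1997FiniteFlatGroupSchemes, (3.7)] -/
theorem comp_convMul_points {C : Type*} [CommRing C] [Algebra R C] (χ : R →ₐ[R] C) (φ ψ : B →ₐ[R] R) :
    χ.comp (toConv φ * toConv ψ).ofConv = (toConv (χ.comp φ) * toConv (χ.comp ψ)).ofConv :=
  AlgHom.comp_convMul_distrib χ (toConv φ) (toConv ψ)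

/-- **Kernel of the reduction map** (head (e), residue form): for `R`-points `φ`, the reductions `residue ∘ φ` and
`residue ∘ ε` AGREE iff `𝔫_φ = 𝔫_ε` (two `R`-algebra maps `B → k` with the same kernel coincide, the residue field being
generated by `R`); combined with `FiniteFlatHopfAlgebraUnitFactor` («`𝔫_φ = 𝔫_ε ⇔ φ(e) = 1 ⇔ φ` factors through the unit
factor») this is «`ker (G(R) → G(k)) = G⁰(R)`». [cite: Tate1997FiniteFlatGroupSchemes, (3.7) (I)] -/
theorem residue_comp_eq_iff_ker_eq (φ ψ : B →ₐ[R] R) :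
    (residue R).comp (φ : B →+* R) = (residue R).comp (ψ : B →+* R) ↔
      RingHom.ker ((residue R).comp (φ : B →+* R)) = RingHom.ker ((residue R).comp (ψ : B →+* R)) := by
  constructor
  · intro h; rw [h]
  · intro h
    ext b
    -- `b ≡ algebraMap (φ b) (mod 𝔫_φ)`, and `𝔫_φ = 𝔫_ψ`
    have hb : b - algebraMap R B (φ b) ∈ RingHom.ker ((residue R).comp (ψ : B →+* R)) := by
      rw [← h, RingHom.mem_ker]; simp
    have key : (residue R) (ψ b) = (residue R) (φ b) := by
      simpa only [RingHom.mem_ker, RingHom.coe_comp, Function.comp_apply, AlgHom.coe_toRingHom, map_sub,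
        AlgHom.commutes, Algebra.algebraMap_self, RingHom.id_apply, sub_eq_zero] using hb
    simpa only [RingHom.coe_comp, Function.comp_apply, AlgHom.coe_toRingHom] using key.symm

end HopfLocal

end LocalFactors

end Literature.RingTheory.Henselian

end
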